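import Mathlib
import Literature.NumberTheory.QuadraticForms.HilbertSymbolUnramified
import Literature.NumberTheory.Automorphic.AdicCompletionLocalField
import Literature.NumberTheory.EllipticCurves.KramerTunnell1982.UnramifiedQuadraticNormProofs

/-!
# STUB-IDEAS k2 g36 — «O'MEARA §63 AND SERRE V §3 ARE IN THE TREE»: typed sketch

Stub-ideation sketch for `stub_heegnerIndexLowerAtTwo` (crux `SplitBadTwoLowerHalfOfFacts`, item
stmt-BirchSwinnertonDyer-27851), card `Ideas/stub-heegnerindexloweratwo-k2-g36.md`.  Technique family 1
(literature transfer / tree match, typed dictionary).  NOTHING here re-types the stub, the crux, the ACTIVE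
skeleton `HeegnerIndexTwo` (`f2bd84c029a8a938`) or the registry line `kside_finite_two` v2; no decl of record
(k2-g35 `UniversalNormsK2G35`, k3-g35 `ReceptacleLadderK3G35`, k1-g34 `NormOntoK1G34`, k1-g27 `artinSchreier*`)
is re-derived.  BSD is NOT proved by any of this.

Contents
* §1 abstract group bookkeeping (KERNEL-CHECKED): index transfer to a subgroup `U` with `U ⊔ N = ⊤`
  (`index_subgroupOf_eq_of_sup_eq_top`), the valuation criterion for `U ⊔ N = ⊤`
  (`sup_eq_top_of_ker_le`), equality from inclusion + equal finite index, «onto + both of order 2 ⟹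
  bijective» (C2's last step), and the assembled abstract C1 (`index_principal_norms_eq_two`).
* §2 THE TREE TRANSFER in the completion presentation `F := v.adicCompletion K` (KERNEL-CHECKED):
  `normIndex_in_principal_eq_two` — O'Meara 63:13a IN THE TREE
  (`Literature…index_quadraticNormSubgroup_adicCompletion_eq_two`, dyadic places included, CFT-free) read on any
  subgroup `U` with `U ⊔ N(F(√u)ˣ) = ⊤`; `located_generator_cond8` — O'Meara 63:16 IN THE TREE
  (`hilbertSymbol_one_add_four_mul_eq_neg_one_iff` ⊕ `hilbertSymbol_comm`): for `ord_v u` odd (the conductor-8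
  keys `u ∈ {±2, ±6}`), `1 + 4ρ` is a NON-norm from `F(√u)` iff `1 + 4ρ ∉ F²` iff `X² − X − ρ̄` has no root in
  the residue field (the Artin–Schreier bit at level `t = 2`); the explicit norm `x² − u·y²` of valuation one
  feeding `sup_eq_top_of_ker_le`; the (G1) instance `IsAdicComplete 𝓂[F] 𝒪[F]` by `inferInstance` (Mathlib
  `NumberTheory/LocalField/Basic` through the tree instance `instIsNonarchimedeanLocalFieldAdicCompletion`); the
  (G3)/(TR1) producers `KramerTunnell1982.exists_val_map_sub_eq_one` / `exists_val_add_map_eq_one` (name checks).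
* §3 Serre V §3 Prop. 5 / Cor. 5 / Cor. 7 with `ℓ = p = 2` as RING IDENTITIES (KERNEL-CHECKED, `ring`): the graded
  norm of the ramified step is Frobenius below the break and Artin–Schreier `x + x²` AT the break `t(key)`
  (`t = 1` for `u ∈ {−1, 3}`, `t = 2` for `u = 2w`, `w` odd), and the norm-coherence of the located generators
  along the unramified `F`-steps (`(1 + 2ᵗa)(1 + 2ᵗb) ≡ 1 + 2ᵗ(a + b)`).
* §4 SIGNATURES (Props, instance currency, NOT proved here; typer items with named tools).
-/

set_option linter.dupNamespace false

namespace Summit.BirchSwinnertonDyer.BirchSwinnertonDyer.Cruxes.SplitBadTwoLowerHalfOfFacts.OMearaTreeK2G36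

/-! ## §1 Abstract group bookkeeping (kernel-checked) -/
section Abstract

variable {G : Type*} [CommGroup G]

/-- (H1) Index transfer: if `U ⊔ N = ⊤` then `[U : U ∩ N] = [G : N]` (Mathlib `Subgroup.relIndex_sup_right`,
`relIndex_top_right`).  Used with `G = Fˣ`, `N = N(Lˣ)`, `U = U¹_F`. -/
theorem index_subgroupOf_eq_of_sup_eq_top (N U : Subgroup G) (hsup : U ⊔ N = ⊤) :
    (N.subgroupOf U).index = N.index := by
  have h : N.relIndex (U ⊔ N) = N.relIndex U := Subgroup.relIndex_sup_right (H := U) (K := N)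
  rw [hsup, Subgroup.relIndex_top_right] at h
  exact h.symm

/-- (H1b) Valuation criterion for `U ⊔ N = ⊤`: if the units (`ker v`) lie in `U ⊔ N` and `N` contains an element
of valuation one, then `U ⊔ N = ⊤`.  Used with `v = ord_F` on `Fˣ`, `ker v = U_F ≤ U¹_F ⊔ N` (for a unit `z`
pick a unit `s` with `s̄² = z̄` — squaring is onto on the finite residue field of characteristic `2` — then
`z s⁻² ∈ U¹_F` and `s² = s² − u·0² ∈ N`), and the explicit norm `x² − u y²` of valuation one (`−u` for conductor 8,
`1 − u` for conductor 4). -/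
theorem sup_eq_top_of_ker_le (v : G →* Multiplicative ℤ) (U N : Subgroup G) (hker : v.ker ≤ U ⊔ N)
    {g : G} (hgN : g ∈ N) (hg : v g = Multiplicative.ofAdd 1) : U ⊔ N = ⊤ := by
  rw [eq_top_iff]
  intro x _
  set n : ℤ := Multiplicative.toAdd (v x) with hn
  have hvx : v x = Multiplicative.ofAdd n := by rw [hn, ofAdd_toAdd]
  have hgn : v (g ^ n) = Multiplicative.ofAdd n := by
    rw [map_zpow, hg, ← ofAdd_zsmul, smul_eq_mul, mul_one]
  have hker' : x * (g ^ n)⁻¹ ∈ v.ker := by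
    rw [MonoidHom.mem_ker, map_mul, map_inv, hvx, hgn, mul_inv_cancel]
  have hx : x = (x * (g ^ n)⁻¹) * g ^ n := by rw [inv_mul_cancel_right]
  rw [hx]
  exact Subgroup.mul_mem _ (hker hker') (Subgroup.mem_sup_right (Subgroup.zpow_mem _ hgN n))

/-- (H1c) Equality from inclusion and equal finite index (conductor-4 located description: `N U¹_L ⊆ H` with
`H = ker(1 + 2ρ ↦ Tr ρ̄)` of index `2` and `[U¹_F : N U¹_L] = 2` force `N U¹_L = H`). -/
theorem eq_of_le_of_index_eq {Γ : Type*} [Group Γ] {A B : Subgroup Γ} (hle : A ≤ B)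
    (hidx : A.index = B.index) (hB : B.index ≠ 0) : A = B := by
  refine le_antisymm hle ?_
  have h := Subgroup.relIndex_mul_index hle
  rw [hidx] at h
  have h1 : A.relIndex B = 1 := by
    have : A.relIndex B * B.index = 1 * B.index := by rw [h, one_mul]
    exact Nat.eq_of_mul_eq_mul_right (Nat.pos_of_ne_zero hB) this
  exact Subgroup.relIndex_eq_one.1 h1

/-- (H1d) C2's last step (XS): an onto map between sets of the same finite cardinality is bijective
(Mathlib `Function.Surjective.bijective_of_nat_card_le`).  With (F-ONTO) (tree
`UnramifiedQuadraticNorm.exists_mul_map_eq_of_sub_one_mem`, instanced by k3-g35 `toLevelCoinv_surjective`) and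
C1 at both levels this is C2. -/
theorem bijective_of_surjective_of_natCard_eq {α β : Type*} {f : α → β} (hf : Function.Surjective f)
    (hα : Nat.card α = 2) (hβ : Nat.card β = 2) : Function.Bijective f := by
  haveI : Finite α := Nat.finite_of_card_ne_zero (by rw [hα]; decide)
  exact hf.bijective_of_nat_card_le (by rw [hα, hβ])

/-- (H1e) Assembled abstract C1: `[Fˣ : N] = 2`, `U¹ ⊔ N = ⊤` and `U¹ ∩ N = N(U¹_L)` give
`[U¹_F : N(U¹_L)] = 2`. -/
theorem index_principal_norms_eq_two {H : Type*} [CommGroup H] (Nmap : H →* G) (U1L : Subgroup H)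
    (U1F Nm : Subgroup G) (h2 : Nm.index = 2) (hsup : U1F ⊔ Nm = ⊤) (hmeet : U1F ⊓ Nm = U1L.map Nmap) :
    ((U1L.map Nmap).subgroupOf U1F).index = 2 := by
  rw [← hmeet, Subgroup.inf_subgroupOf_left, index_subgroupOf_eq_of_sup_eq_top Nm U1F hsup, h2]

end Abstract

/-! ## §2 The tree transfer in the completion presentation `F := v.adicCompletion K` (kernel-checked) -/
section Tree

open NumberField IsDedekindDomain
open Literature.NumberTheory.QuadraticForms

variable (K : Type) [Field K] [NumberField K] (v : HeightOneSpectrum (𝓞 K))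

/-- **KER-2 / C1 core = O'Meara 63:13a IN THE TREE.**  For `u ∈ F = K_v` a non-square (ANY finite place, dyadic
included) and any subgroup `U ≤ Fˣ` with `U ⊔ N(F(√u)ˣ) = ⊤`: `[U : U ∩ N(F(√u)ˣ)] = 2`.  CFT-free (the tree
proves 63:13a by counting square classes).  With `U = U¹_F` (§4 signatures) this is `#Ĥ⁰(Δ_m, U¹(L_m)) = 2`. -/
theorem normIndex_in_principal_eq_two {u : v.adicCompletion K} (hu0 : u ≠ 0) (hu : ¬ IsSquare u)
    (U : Subgroup (v.adicCompletion K)ˣ)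
    (hsup : U ⊔ quadraticNormSubgroup (v.adicCompletion K) u = ⊤) :
    ((quadraticNormSubgroup (v.adicCompletion K) u).subgroupOf U).index = 2 := by
  rw [index_subgroupOf_eq_of_sup_eq_top _ _ hsup]
  exact index_quadraticNormSubgroup_adicCompletion_eq_two K v hu0 hu

/-- The explicit norm of valuation `ord_v(x² − u y²)` feeding `sup_eq_top_of_ker_le`: `x² − u·y²` is a norm from
`F(√u)` by definition (`(x, y) = (0, 1)`: `−u`, valuation `1` on the conductor-8 keys; `(1, 1)`: `1 − u ∈ {2, −2}`
on the conductor-4 keys `u ∈ {−1, 3}`). -/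
theorem sq_sub_mul_sq_mem_quadraticNormSubgroup (u x y : v.adicCompletion K) (h0 : x ^ 2 - u * y ^ 2 ≠ 0) :
    Units.mk0 (x ^ 2 - u * y ^ 2) h0 ∈ quadraticNormSubgroup (v.adicCompletion K) u :=
  (mem_quadraticNormSubgroup_iff).2 ⟨x, y, rfl⟩

/-- **The located generator on the conductor-8 keys = O'Meara 63:16 IN THE TREE.**  At a dyadic place, for
`ord_v u` odd (`u ∈ {±2, ±6}·Fˣ²`): `1 + 4ρ` is a NON-norm from `F(√u)` iff `1 + 4ρ ∉ F²` — iff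
`X² − X − ρ̄` has no root in the residue field (`isSquare_one_add_four_mul_adicCompletion_iff`), i.e. iff the
Artin–Schreier class of `ρ̄` in `k/℘(k) ≅ ℤ/2` is non-trivial: the located `2`-torsion at level `t = 2`. -/
theorem located_generator_cond8 (h2 : (2 : 𝓞 K) ∈ v.asIdeal) (ρ : 𝓞 K) {u : v.adicCompletion K}
    (hu0 : u ≠ 0) (hord : Odd (WithZero.log (Valued.v u)))
    (h0 : algebraMap (𝓞 K) (v.adicCompletion K) (1 + 4 * ρ) ≠ 0) :
    Units.mk0 (algebraMap (𝓞 K) (v.adicCompletion K) (1 + 4 * ρ)) h0 ∉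
        quadraticNormSubgroup (v.adicCompletion K) u ↔
      ¬ IsSquare (algebraMap (𝓞 K) (v.adicCompletion K) (1 + 4 * ρ)) := by
  haveI : CharZero (v.adicCompletion K) :=
    charZero_of_injective_algebraMap (algebraMap K _).injective
  rw [← hilbertSymbol_eq_neg_one_iff_not_mem_quadraticNormSubgroup hu0, Units.val_mk0, hilbertSymbol_comm,
    hilbertSymbol_one_add_four_mul_eq_neg_one_iff K v ρ (one_add_four_mul_notMem K v h2 ρ) hu0]
  exact ⟨fun h ↦ h.1, fun h ↦ ⟨h, hord⟩⟩

/-- `1 + 4ρ` is a `v`-unit, hence non-zero in `K_v` (tree `valued_one_add_four_mul_eq_one`). -/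
theorem one_add_four_mul_ne_zero (h2 : (2 : 𝓞 K) ∈ v.asIdeal) (ρ : 𝓞 K) :
    algebraMap (𝓞 K) (v.adicCompletion K) (1 + 4 * ρ) ≠ 0 := fun h0 ↦ by
  have h1 := valued_one_add_four_mul_eq_one K v h2 ρ
  rw [h0, map_zero] at h1
  exact zero_ne_one h1

open scoped ValuativeRel in
/-- **(G1) in the completion presentation is an INSTANCE**: the unit ball of `K_v` is adically complete and
separated (Mathlib `NumberTheory/LocalField/Basic`, through the tree instance
`Literature.NumberTheory.Automorphic.instIsNonarchimedeanLocalFieldAdicCompletion`). -/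
example : IsAdicComplete 𝓂[v.adicCompletion K] 𝒪[v.adicCompletion K] := inferInstance

open scoped ValuativeRel in
/-- … and its residue field is finite, the unit ball is a DVR (same source). -/
example : Finite 𝓀[v.adicCompletion K] ∧ IsDiscreteValuationRing 𝒪[v.adicCompletion K] :=
  ⟨inferInstance, inferInstance⟩

/-- **(G3) / k1-g34's residual (TR1) producer is a TREE THEOREM** (name check): for an isometric involution
`σ ≠ 1` of a non-archimedean local field with a `σ`-fixed uniformiser (the unramified `F`-step), some integer
`x` has `‖σx − x‖ = 1`, and some integer `θ` has `‖θ + σθ‖ = 1`. -/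
example := @Literature.NumberTheory.EllipticCurves.KramerTunnell1982.exists_val_map_sub_eq_one
example := @Literature.NumberTheory.EllipticCurves.KramerTunnell1982.exists_val_add_map_eq_one

/-- The L-step bridge (name check): `K_v(√b) ≃ L_w` as rings for `L = K(√b)`, `w ∣ v` inert-or-ramified (tree,
`LocalNormIndex` step 3) — the ramified step `L_m = F_m(√u)` is itself a completion. -/
example := @Literature.NumberTheory.QuadraticForms.exists_ringEquiv_quadraticAlgebra_adicCompletion

end Tree

/-! ## §3 Serre V §3 (ℓ = p = 2) as ring identities (kernel-checked) -/
section Serre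

variable {R : Type*} [CommRing R]

/-- Conductor 4, key `u = −1`, uniformiser `π_L = 1 + √u`, break `t = 1`: `N(1 + x·π_L) = (1 + x)² − u x²
= 1 + 2(x + x²)` — the graded norm at level `1` IS Artin–Schreier (Serre V §3 Prop. 5 (iii), Cor. 5). -/
theorem gradedNorm_t1_key_neg_one (x : R) : (1 + x) ^ 2 - (-1) * x ^ 2 = 1 + 2 * (x + x ^ 2) := by ring

/-- Conductor 4, key `u = 3`: the same modulo `4`. -/
theorem gradedNorm_t1_key_three (x : R) :
    (1 + x) ^ 2 - 3 * x ^ 2 = 1 + 2 * (x + x ^ 2) - 4 * x ^ 2 := by ring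

/-- Conductor 8, `u = 2w`, `w = 2k + 1`, uniformiser `√u`, break `t = 2`; level `1 < t`:
`N(1 + x√u) = 1 − u x² ≡ 1 + 2x²` (Frobenius, Prop. 5 (ii): bijective on a perfect residue field). -/
theorem gradedNorm_t2_level_one (k x : R) :
    1 - (2 * (2 * k + 1)) * x ^ 2 = 1 + 2 * x ^ 2 - 4 * ((k + 1) * x ^ 2) := by ring

/-- Conductor 8, level `2 = t`: `N(1 + u x) = (1 + u x)² ≡ 1 + 4(x + x²) (mod 8)` — Artin–Schreier AT the break
(Prop. 5 (iii), Cor. 5: `Coker N_t ≅ k/℘(k)`). -/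
theorem gradedNorm_t2_level_two (k x : R) :
    (1 + (2 * (2 * k + 1)) * x) ^ 2 = 1 + 4 * (x + x ^ 2) + 8 * (k * x + (2 * k ^ 2 + 2 * k) * x ^ 2) := by
  ring

/-- Norm-coherence of the located generators along an unramified quadratic `F`-step (explicit C2): at level
`2`, `(1 + 4a)(1 + 4b) = 1 + 4(a + b) + 16ab`, so `N_{F_{m+1}/F_m}(1 + 4ρ) ≡ 1 + 4·Tr ρ (mod 8)` and the
Artin–Schreier classes compose by `Tr_{k_{m+1}/𝔽₂} = Tr_{k_m/𝔽₂} ∘ Tr_{k_{m+1}/k_m}` (Mathlib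
`Algebra.trace_comp_trace`). -/
theorem locatedGenerator_coherence_level_two (a b : R) :
    (1 + 4 * a) * (1 + 4 * b) = 1 + 4 * (a + b) + 8 * (2 * a * b) := by ring

/-- … and at level `1` (conductor 4): `(1 + 2a)(1 + 2b) = 1 + 2(a + b) + 4ab`. -/
theorem locatedGenerator_coherence_level_one (a b : R) :
    (1 + 2 * a) * (1 + 2 * b) = 1 + 2 * (a + b) + 4 * (a * b) := by ring

/-- Conductor 4, the inclusion `N(U¹_L) ⊆ ker(1 + 2ρ ↦ Tr ρ̄)`: for `y = a + b√u ∈ U¹_L` one has `a + b = 1 + 2c`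
and `N y = a² − u b² = 1 + 2ρ` with `ρ ≡ −ab + 2(…)`; here the exact identity for `u = −1 + 4d`. -/
theorem norm_principal_cond4 (a b c d : R) (hab : a + b = 1 + 2 * c) :
    a ^ 2 - (-1 + 4 * d) * b ^ 2 = 1 + 2 * (-(a * b) + 2 * (c + c ^ 2 - d * b ^ 2)) := by
  have hb : b = 1 + 2 * c - a := by rw [← hab]; ring
  subst hb
  ring

end Serre

/-! ## §4 Signatures (instance currency; NOT proved here — typer items with named tools) -/
section Signatures

/-- SIGNATURE (B1′ ∧ B2), for the ramified quadratic step `N : Lˣ → Fˣ`: the principal units of `F` that are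
norms are norms of PRINCIPAL units, `U¹_F ∩ N(Lˣ) = N(U¹_L)`.  Tools: `v_F(N y) = v_L(y)` (totally ramified,
`f = 1`; Serre V §3 Cor. 7 step c)) puts `y` in `U_L`; then `N y ≡ ȳ² (mod 𝔭)` and `ȳ² = 1 ⟹ ȳ = 1` in the residue
field `k` (`#kˣ = q − 1` odd: squaring is injective on `kˣ`), so `y ∈ U¹_L` — no Teichmüller splitting needed
(Serre V §3 Cor. 7 step b) read on `U¹`). -/
def NormsOfPrincipalUnits {H GF : Type*} [CommGroup H] [CommGroup GF] (Nmap : H →* GF)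
    (U1L : Subgroup H) (U1F Nm : Subgroup GF) : Prop :=
  U1F ⊓ Nm = U1L.map Nmap

/-- SIGNATURE (conductor-4 located description): `N(U¹_L) = ker(φ)` for the homomorphism
`φ : U¹_F → ℤ/2`, `1 + 2ρ ↦ Tr_{k/𝔽₂} ρ̄` (well defined modulo `U²_F ⊆ N U¹_L`-corrections by §3
`locatedGenerator_coherence_level_one`); inclusion `⊆` by `norm_principal_cond4` and
`Tr(ā b̄) = Tr(℘(ā)) = 0` (`ā + b̄ = 1`, Frobenius-invariance of the trace, Mathlib `Algebra.trace_eq_of_algEquiv`),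
equality by `eq_of_le_of_index_eq` with §2 `normIndex_in_principal_eq_two`. -/
def LocatedKernelCondFour {GF : Type*} [CommGroup GF] (U1F NU1L : Subgroup GF) (φ : U1F →* Multiplicative (ZMod 2)) :
    Prop :=
  NU1L.subgroupOf U1F = φ.ker ∧ Function.Surjective φ

/-- SIGNATURE (KER-2 as a limit, XS in k3-g35's `limMap` currency): an inverse system of BIJECTIONS between
groups of order `2` has limit of order `2`; as a `Λ_v`-module the located group is `Λ_v/𝔪 = 𝔽₂` (forced:
`Aut(ℤ/2) = 1`, so `Γ` and `Δ` act trivially). -/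
def KerTwoLimit (A : ℕ → Type*) [∀ m, AddCommGroup (A m)] (t : ∀ m, A (m + 1) →+ A m) : Prop :=
  (∀ m, Nat.card (A m) = 2) → (∀ m, Function.Bijective (t m)) →
    Nat.card {x : ∀ m, A m // ∀ m, t m (x (m + 1)) = x m} = 2

end Signatures

end Summit.BirchSwinnertonDyer.BirchSwinnertonDyer.Cruxes.SplitBadTwoLowerHalfOfFacts.OMearaTreeK2G36
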